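import Summits.AtomisticToContinuum.FouriersLaw.Theorems.PhononMeanFreePathDefs
import Summits.AtomisticToContinuum.FouriersLaw.Theorems.BondHeatUncertaintySubdiffusiveBondHeatKernelDetailedBalance
import Summits.AtomisticToContinuum.FouriersLaw.Theorems.PhononMeanFreePathIncoherentChannelLightConeHelper2
import Summits.AtomisticToContinuum.FouriersLaw.Theorems.PhononMeanFreePathIncoherentChannelReflection

/-!
# Time reversal of the near-bath kinetic autocovariance (line `two-horizons-forecast-loss`, crux `IncoherentChannel`)

Helper file of line `two-horizons-forecast-loss` of crux `PhononMeanFreePath.IncoherentChannel`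
(stmt-AtomisticToContinuum-11811), stub group "KineticAutocovTimeReversal".

Setting: `P = pinnedChain ω₂ lam β γ` (`ω₂, lam, β, γ > 0`), the `(N+1)`-site chain `0..N` with both baths at
`T > 0`, `μ₀ = P.gibbsMeasure (N+1) T` (invariant), `K_t = P.transitionKernel (N+1) T T t⁺` (Markov,
Chapman–Kolmogorov), `Θ(q,p) = (q,-p)` and the site reflection `R : i ↦ N - i`. With the centred kinetic energies
`e_0 = p_0² - T`, `e_N = p_N² - T`, the NEAR-BATH KINETIC AUTOCOVARIANCE is `A_N(t) = ⟨e_0, K_t e_0⟩_{μ₀}` (the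
first kernel of the sum rule `∫₀^∞ (A_N + C_N) = T²/γ`, `IncoherentBounded.sumRule`) and the ENERGY-FORECAST NORM
is `E_N(t) = ‖K_t e_N‖²_{L²(μ₀)} = ∫ (K_t p_N² - T)² dμ₀`.

* `endKineticAutocov_timeReversal` (registered) — `A_N(s+u) = ⟨(K_u e_0)∘Θ, K_s e_0⟩_{μ₀}` for `s, u ≥ 0`:
  Chapman–Kolmogorov `K_{s+u} e_0 = K_s (K_u e_0)` (`kinAutocov_kinFcast_add`), kernel detailed balance
  (`SubdiffusiveBondHeat.pinnedChain_detailedBalance`) with `f = e_0`, `h = K_u e_0`, and `e_0∘Θ = e_0` — the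
  even-sector twin of the echo identity of the momentum forecast;
* `abs_endKineticAutocov_two_mul_le_energyForecast` (registered) — `|A_N(2t)| ≤ E_N(t)` for `t ≥ 0`: AM–GM at
  `s = u = t`, `‖(K_t e_0)∘Θ‖ = ‖K_t e_0‖` (`Θ` preserves `μ₀`) and `‖K_t e_0‖ = ‖K_t e_N‖`
  (`kinAutocov_kinFcastNorm_reflect`: `K_t(R z, ·) = R_* K_t(z, ·)`, `OddSectorWitness.transitionKernel_siteReflection`,
  and `R_* μ₀ = μ₀`, `NonBallistic.measurePreserving_siteReflection_gibbsMeasure`).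
-/

noncomputable section

namespace Summit.AtomisticToContinuum.FouriersLaw.Theorems.PhononMeanFreePath

open MeasureTheory Set Filter Topology
open scoped NNReal
open Literature.MathematicalPhysics.KineticTheory.HeatConduction
open Summit.AtomisticToContinuum.FouriersLaw.Theorems.SubdiffusiveBondHeat
  (pinnedChain_detailedBalance pinnedChain_sq_act_le_of_sq_integrable abs_integral_mul_le_weighted)
open Summit.AtomisticToContinuum.FouriersLaw.Theorems.IncoherentChannel.Negative.KernelMoments
  (integrable_sq_momentum_transitionKernel)
open Summit.AtomisticToContinuum.FouriersLaw.Cruxes.SuperadditiveResistance.FloatingProbeBypassLaplacian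
  (integral_flip_gibbsMeasure integrable_flip_gibbsMeasure)
open Summit.AtomisticToContinuum.FouriersLaw.Theorems.OddSectorWitness (transitionKernel_siteReflection)
open Summit.AtomisticToContinuum.FouriersLaw.Theorems.NonBallistic (measurePreserving_siteReflection_gibbsMeasure)

/-! ### The centred kinetic energy `e_0 = p_0² - T` and its kernel forecast `K_t e_0` -/

/-- The kinetic forecast `z ↦ (K_t e_0)(z) = ∫ (p_0² - T) dK_t(z, ·)` is a measurable function of the initial
microstate. [folklore] -/
theorem kinAutocov_measurable_kinFcast (ω₂ lam β γ T : ℝ) (N : ℕ) (t : ℝ≥0) :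
    Measurable fun z : PhaseSpace (N + 1) =>
      ∫ y, (y.2 0 ^ 2 - T) ∂((pinnedChain ω₂ lam β γ).transitionKernel (N + 1) T T t z) := by
  have h : StronglyMeasurable fun y : PhaseSpace (N + 1) => y.2 0 ^ 2 - T :=
    (by fun_prop : Measurable fun y : PhaseSpace (N + 1) => y.2 0 ^ 2 - T).stronglyMeasurable
  exact (h.integral_kernel (κ := (pinnedChain ω₂ lam β γ).transitionKernel (N + 1) T T t)).measurable

section Setting

variable {ω₂ lam β γ T : ℝ} (hω : 0 < ω₂) (hT : 0 < T)

include hω hT in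
/-- `e_0² = (p_0² - T)² ∈ L¹(μ₀)`: all moments of `p_0` under the Gibbs state are finite (its marginal is
`N(0,T)`, `lightCone_integrable_momentum_pow`). [folklore] -/
theorem kinAutocov_integrable_sq_kinObs (hl : 0 ≤ lam) (hβ : 0 ≤ β) (N : ℕ) :
    Integrable (fun z : PhaseSpace (N + 1) => (z.2 0 ^ 2 - T) ^ 2)
      ((pinnedChain ω₂ lam β γ).gibbsMeasure (N + 1) T) := by
  haveI := pinnedChain_isProbabilityMeasure_gibbsMeasure hω hl hβ γ (N + 1) hT
  have h4 := lightCone_integrable_momentum_pow (γ := γ) hω hl hβ hT (0 : Fin (N + 1)) 4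
  have h2 := lightCone_integrable_momentum_pow (γ := γ) hω hl hβ hT (0 : Fin (N + 1)) 2
  exact ((h4.sub' (h2.const_mul (2 * T))).fun_add (integrable_const (T ^ 2))).congr
    (Eventually.of_forall fun z => by ring)

include hω hT in
/-- `(K_t e_0)(z) = (K_t p_0²)(z) - T` pointwise: `K_t(z, ·)` is a probability measure and `p_0² ∈ L¹(K_t(z, ·))`
(CEHR (3.4), `integrable_sq_momentum_transitionKernel`). [folklore] -/
theorem kinAutocov_kinFcast_eq (hl : 0 ≤ lam) (hβ : 0 ≤ β) (hγ : 0 ≤ γ) (N : ℕ) (t : ℝ≥0)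
    (z : PhaseSpace (N + 1)) :
    ∫ y, (y.2 0 ^ 2 - T) ∂((pinnedChain ω₂ lam β γ).transitionKernel (N + 1) T T t z) =
      (∫ y, y.2 0 ^ 2 ∂((pinnedChain ω₂ lam β γ).transitionKernel (N + 1) T T t z)) - T := by
  haveI := pinnedChain_isMarkovKernel_transitionKernel hω hl hβ hγ (N + 1) T T t
  rw [integral_sub (integrable_sq_momentum_transitionKernel hω hl hβ hγ (Nat.add_one_pos N) hT t z 0)
    (integrable_const T), integral_const, probReal_univ, one_smul]

include hω hT in
/-- **Chapman–Kolmogorov for the kinetic forecast**, pointwise: `(K_{s+u} e_0)(z) = (K_s (K_u e_0))(z)` for every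
microstate `z` and `s, u ≥ 0` (`K_{s+u} = K_u ∘ₖ K_s`, `pinnedChain_transitionKernel_add`, and
`e_0 ∈ L¹(K_{s+u}(z, ·))`). [folklore] -/
theorem kinAutocov_kinFcast_add (hl : 0 ≤ lam) (hβ : 0 ≤ β) (hγ : 0 ≤ γ) (N : ℕ) {s u : ℝ} (hs : 0 ≤ s)
    (hu : 0 ≤ u) (z : PhaseSpace (N + 1)) :
    ∫ y, (y.2 0 ^ 2 - T) ∂((pinnedChain ω₂ lam β γ).transitionKernel (N + 1) T T (s + u).toNNReal z) =
      ∫ y, (∫ y', (y'.2 0 ^ 2 - T) ∂((pinnedChain ω₂ lam β γ).transitionKernel (N + 1) T T u.toNNReal y))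
        ∂((pinnedChain ω₂ lam β γ).transitionKernel (N + 1) T T s.toNNReal z) := by
  rw [Real.toNNReal_add hs hu, pinnedChain_transitionKernel_add hω hl hβ hγ (N + 1) T T s.toNNReal u.toNNReal]
  refine ProbabilityTheory.Kernel.integral_comp ?_
  rw [← pinnedChain_transitionKernel_add hω hl hβ hγ (N + 1) T T s.toNNReal u.toNNReal]
  haveI := pinnedChain_isMarkovKernel_transitionKernel hω hl hβ hγ (N + 1) T T (s.toNNReal + u.toNNReal)
  exact (integrable_sq_momentum_transitionKernel hω hl hβ hγ (Nat.add_one_pos N) hT _ z 0).sub' (integrable_const T)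

include hω hT in
/-- **The centred energy forecast is square integrable**: `(K_t p_0² - T)² ∈ L¹(μ₀)` for every `t ≥ 0` — the
`L²(μ₀)`-contraction of `K_t` (`pinnedChain_sq_act_le_of_sq_integrable`, Jensen + invariance) applied to
`e_0 ∈ L²(μ₀)`, and `K_t e_0 = K_t p_0² - T`. [folklore] -/
theorem kinAutocov_integrable_sq_kinFcast (hl : 0 < lam) (hβ : 0 < β) (hγ : 0 < γ) (N : ℕ) (t : ℝ≥0) :
    Integrable (fun z : PhaseSpace (N + 1) =>
        ((∫ y, y.2 0 ^ 2 ∂((pinnedChain ω₂ lam β γ).transitionKernel (N + 1) T T t z)) - T) ^ 2)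
      ((pinnedChain ω₂ lam β γ).gibbsMeasure (N + 1) T) := by
  have hem : Measurable fun z : PhaseSpace (N + 1) => z.2 0 ^ 2 - T := by fun_prop
  obtain ⟨-, hG2, -⟩ := pinnedChain_sq_act_le_of_sq_integrable hω hl hβ hγ (Nat.add_one_pos N) hT hem
    (kinAutocov_integrable_sq_kinObs hω hT hl.le hβ.le N) t
  refine hG2.congr (Eventually.of_forall fun z => ?_)
  beta_reduce
  rw [kinAutocov_kinFcast_eq hω hT hl.le hβ.le hγ.le N t z]

/-! ### Left–right reflection of the energy forecast -/

include hω in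
/-- **The left energy forecast is the reflected right one**, pointwise: `(K_t p_0²)(R z) = (K_t p_N²)(z)` for the
chain with both baths at the same temperature (`K_t(R z, ·) = R_* K_t(z, ·)`, `transitionKernel_siteReflection`;
`p_0 ∘ R = p_N`; change of variables along the measurable involution `siteReflectionEquiv`, no integrability
needed). [folklore] -/
theorem kinAutocov_sqFcast_siteReflection (hl : 0 ≤ lam) (hβ : 0 ≤ β) (hγ : 0 ≤ γ) (T : ℝ) (N : ℕ) (t : ℝ≥0)
    (z : PhaseSpace (N + 1)) :
    ∫ y, y.2 0 ^ 2 ∂((pinnedChain ω₂ lam β γ).transitionKernel (N + 1) T T t (siteReflection (N + 1) z)) =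
      ∫ y, y.2 (Fin.last N) ^ 2 ∂((pinnedChain ω₂ lam β γ).transitionKernel (N + 1) T T t z) := by
  have hR : MeasurableEmbedding (siteReflection (N + 1)) := (siteReflectionEquiv (N + 1)).measurableEmbedding
  rw [transitionKernel_siteReflection hω hl hβ hγ (N + 1) T t z, hR.integral_map]
  simp only [siteReflection_snd, Fin.rev_zero]

include hω in
/-- **Reflection identity for the energy-forecast norm**: `∫ (K_t p_0² - T)² dμ₀ = ∫ (K_t p_N² - T)² dμ₀` for the
chain with both baths at the same temperature `T` (`kinAutocov_sqFcast_siteReflection` and `R_* μ₀ = μ₀`,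
`measurePreserving_siteReflection_gibbsMeasure` with the even interaction `pinnedChain_V_neg`; no integrability
needed). [folklore] -/
theorem kinAutocov_kinFcastNorm_reflect (hl : 0 ≤ lam) (hβ : 0 ≤ β) (hγ : 0 ≤ γ) (T : ℝ) (N : ℕ) (t : ℝ≥0) :
    ∫ z, ((∫ y, y.2 0 ^ 2 ∂((pinnedChain ω₂ lam β γ).transitionKernel (N + 1) T T t z)) - T) ^ 2
        ∂((pinnedChain ω₂ lam β γ).gibbsMeasure (N + 1) T) =
      ∫ z, ((∫ y, y.2 (Fin.last N) ^ 2 ∂((pinnedChain ω₂ lam β γ).transitionKernel (N + 1) T T t z)) - T) ^ 2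
        ∂((pinnedChain ω₂ lam β γ).gibbsMeasure (N + 1) T) := by
  have hR := measurePreserving_siteReflection_gibbsMeasure (pinnedChain ω₂ lam β γ) (pinnedChain_V_neg ω₂ lam β γ)
    (N + 1) T
  symm
  calc ∫ z, ((∫ y, y.2 (Fin.last N) ^ 2 ∂((pinnedChain ω₂ lam β γ).transitionKernel (N + 1) T T t z)) - T) ^ 2
        ∂((pinnedChain ω₂ lam β γ).gibbsMeasure (N + 1) T)
      = ∫ z, ((∫ y, y.2 0 ^ 2 ∂((pinnedChain ω₂ lam β γ).transitionKernel (N + 1) T T t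
          (siteReflection (N + 1) z))) - T) ^ 2 ∂((pinnedChain ω₂ lam β γ).gibbsMeasure (N + 1) T) := by
        refine integral_congr_ae (Eventually.of_forall fun z => ?_)
        simp only [kinAutocov_sqFcast_siteReflection hω hl hβ hγ]
    _ = ∫ z, ((∫ y, y.2 0 ^ 2 ∂((pinnedChain ω₂ lam β γ).transitionKernel (N + 1) T T t z)) - T) ^ 2
          ∂((pinnedChain ω₂ lam β γ).gibbsMeasure (N + 1) T) :=
        hR.integral_comp (siteReflectionEquiv (N + 1)).measurableEmbedding
          (fun z => ((∫ y, y.2 0 ^ 2 ∂((pinnedChain ω₂ lam β γ).transitionKernel (N + 1) T T t z)) - T) ^ 2)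

end Setting

/-! ### The registered stubs -/

/-- **Time reversal of the near-bath kinetic autocovariance (registered stub `endKineticAutocov_timeReversal`).**
For the pinned chain with both baths at `T` and `s, u ≥ 0`:
`A_N(s+u) = ⟨e_0, K_{s+u} e_0⟩_{μ₀} = ∫ ((K_u p_0²)(Θz) - T) ((K_s p_0²)(z) - T) dμ₀(z)` — Chapman–Kolmogorov
`K_{s+u} e_0 = K_s (K_u e_0)`, kernel detailed balance `∫ f (K_s h) dμ₀ = ∫ (h∘Θ) K_s (f∘Θ) dμ₀` with `f = e_0`,
`h = K_u e_0` (both in `L²(μ₀)`), `e_0 ∘ Θ = e_0`, and `K_t e_0 = K_t p_0² - T`. [folklore] -/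
theorem endKineticAutocov_timeReversal : ∀ ω₂ lam β γ : ℝ, 0 < ω₂ → 0 < lam → 0 < β → 0 < γ → ∀ T : ℝ, 0 < T → ∀ N : ℕ, 1 ≤ N → ∀ s u : ℝ, 0 ≤ s → 0 ≤ u → ∫ z, ((z.2 0) ^ 2 - T) * (∫ y, ((y.2 0) ^ 2 - T) ∂((pinnedChain ω₂ lam β γ).transitionKernel (N + 1) T T (s + u).toNNReal z)) ∂((pinnedChain ω₂ lam β γ).gibbsMeasure (N + 1) T) = ∫ z, ((∫ y, (y.2 0) ^ 2 ∂((pinnedChain ω₂ lam β γ).transitionKernel (N + 1) T T u.toNNReal (z.1, -z.2))) - T) * ((∫ y, (y.2 0) ^ 2 ∂((pinnedChain ω₂ lam β γ).transitionKernel (N + 1) T T s.toNNReal z)) - T) ∂((pinnedChain ω₂ lam β γ).gibbsMeasure (N + 1) T) := by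
  intro ω₂ lam β γ hω hl hβ hγ T hT N _ s u hs hu
  have hem : Measurable fun z : PhaseSpace (N + 1) => z.2 0 ^ 2 - T := by fun_prop
  have he2 := kinAutocov_integrable_sq_kinObs (γ := γ) hω hT hl.le hβ.le N
  have hGm := kinAutocov_measurable_kinFcast ω₂ lam β γ T N u.toNNReal
  obtain ⟨-, hG2, -⟩ := pinnedChain_sq_act_le_of_sq_integrable hω hl hβ hγ (Nat.add_one_pos N) hT hem he2 u.toNNReal
  calc ∫ z, (z.2 0 ^ 2 - T) * (∫ y, (y.2 0 ^ 2 - T)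
          ∂((pinnedChain ω₂ lam β γ).transitionKernel (N + 1) T T (s + u).toNNReal z))
          ∂((pinnedChain ω₂ lam β γ).gibbsMeasure (N + 1) T)
      = ∫ z, (z.2 0 ^ 2 - T) * (∫ y, (∫ y', (y'.2 0 ^ 2 - T)
          ∂((pinnedChain ω₂ lam β γ).transitionKernel (N + 1) T T u.toNNReal y))
          ∂((pinnedChain ω₂ lam β γ).transitionKernel (N + 1) T T s.toNNReal z))
          ∂((pinnedChain ω₂ lam β γ).gibbsMeasure (N + 1) T) := by
        simp_rw [kinAutocov_kinFcast_add hω hT hl.le hβ.le hγ.le N hs hu]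
    _ = ∫ z, (∫ y', (y'.2 0 ^ 2 - T) ∂((pinnedChain ω₂ lam β γ).transitionKernel (N + 1) T T u.toNNReal (z.1, -z.2))) *
          (∫ y, (fun y : PhaseSpace (N + 1) => y.2 0 ^ 2 - T) (y.1, -y.2)
            ∂((pinnedChain ω₂ lam β γ).transitionKernel (N + 1) T T s.toNNReal z))
          ∂((pinnedChain ω₂ lam β γ).gibbsMeasure (N + 1) T) :=
        pinnedChain_detailedBalance hω hl hβ hγ (Nat.add_one_pos N) hT hem hGm he2 hG2 s.toNNReal
    _ = ∫ z, ((∫ y, y.2 0 ^ 2 ∂((pinnedChain ω₂ lam β γ).transitionKernel (N + 1) T T u.toNNReal (z.1, -z.2))) - T) *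
          ((∫ y, y.2 0 ^ 2 ∂((pinnedChain ω₂ lam β γ).transitionKernel (N + 1) T T s.toNNReal z)) - T)
          ∂((pinnedChain ω₂ lam β γ).gibbsMeasure (N + 1) T) := by
        refine integral_congr_ae (Eventually.of_forall fun z => ?_)
        simp only [Pi.neg_apply, neg_sq]
        rw [kinAutocov_kinFcast_eq hω hT hl.le hβ.le hγ.le N u.toNNReal (z.1, -z.2),
          kinAutocov_kinFcast_eq hω hT hl.le hβ.le hγ.le N s.toNNReal z]

/-- **Energy-forecast bound on the kinetic autocovariance (registered stub
`abs_endKineticAutocov_two_mul_le_energyForecast`).** For the pinned chain with both baths at `T` and `t ≥ 0`: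
`|A_N(2t)| ≤ E_N(t) = ∫ (K_t p_N² - T)² dμ₀` — the time-reversal identity at `s = u = t`, AM–GM
`|∫ (G∘Θ) G dμ₀| ≤ (‖G∘Θ‖² + ‖G‖²)/2 = ‖G‖²` for `G = K_t p_0² - T` (`Θ` preserves `μ₀`), and the left–right
reflection `‖K_t p_0² - T‖_{L²(μ₀)} = ‖K_t p_N² - T‖_{L²(μ₀)}` (`kinAutocov_kinFcastNorm_reflect`). [folklore] -/
theorem abs_endKineticAutocov_two_mul_le_energyForecast : ∀ ω₂ lam β γ : ℝ, 0 < ω₂ → 0 < lam → 0 < β → 0 < γ → ∀ T : ℝ, 0 < T → ∀ N : ℕ, 1 ≤ N → ∀ t : ℝ, 0 ≤ t → |∫ z, ((z.2 0) ^ 2 - T) * (∫ y, ((y.2 0) ^ 2 - T) ∂((pinnedChain ω₂ lam β γ).transitionKernel (N + 1) T T (2 * t).toNNReal z)) ∂((pinnedChain ω₂ lam β γ).gibbsMeasure (N + 1) T)| ≤ ∫ z, ((∫ y, (y.2 (Fin.last N)) ^ 2 ∂((pinnedChain ω₂ lam β γ).transitionKernel (N + 1) T T t.toNNReal z)) - T)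 ^ 2 ∂((pinnedChain ω₂ lam β γ).gibbsMeasure (N + 1) T) := by
  intro ω₂ lam β γ hω hl hβ hγ T hT N hN t ht
  rw [two_mul, endKineticAutocov_timeReversal ω₂ lam β γ hω hl hβ hγ T hT N hN t t ht ht]
  have hG2 := kinAutocov_integrable_sq_kinFcast hω hT hl hβ hγ N t.toNNReal
  have hGΘ2 : Integrable (fun z : PhaseSpace (N + 1) =>
      ((∫ y, y.2 0 ^ 2 ∂((pinnedChain ω₂ lam β γ).transitionKernel (N + 1) T T t.toNNReal (z.1, -z.2))) - T) ^ 2)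
      ((pinnedChain ω₂ lam β γ).gibbsMeasure (N + 1) T) :=
    integrable_flip_gibbsMeasure (pinnedChain ω₂ lam β γ) (N + 1) T
      (F := fun z => ((∫ y, y.2 0 ^ 2 ∂((pinnedChain ω₂ lam β γ).transitionKernel (N + 1) T T t.toNNReal z)) - T) ^ 2)
      hG2
  have h := abs_integral_mul_le_weighted hGΘ2 hG2 one_pos
  rw [inv_one, one_mul, one_mul, integral_flip_gibbsMeasure (pinnedChain ω₂ lam β γ) (N + 1) T
      (fun z => ((∫ y, y.2 0 ^ 2 ∂((pinnedChain ω₂ lam β γ).transitionKernel (N + 1) T T t.toNNReal z)) - T) ^ 2),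
    kinAutocov_kinFcastNorm_reflect hω hl.le hβ.le hγ.le T N t.toNNReal] at h
  linarith

end Summit.AtomisticToContinuum.FouriersLaw.Theorems.PhononMeanFreePath

end
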